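import Summits.NavierStokesRegularity.NavierStokesRegularity.Theses.QuantisedSymmetry
import Summits.NavierStokesRegularity.NavierStokesRegularity.Theses.Blowup
import Summits.NavierStokesRegularity.NavierStokesRegularity.Theses.AncientHullSteering
import Summits.NavierStokesRegularity.NavierStokesRegularity.Theorems.QuantisedSymmetryPolyhedralTruncationBridge
import Summits.NavierStokesRegularity.NavierStokesRegularity.Theorems.QuantisedSymmetryPolyhedralDssProfileExistsDominatesBlowupProfile
import Summits.NavierStokesRegularity.NavierStokesRegularity.Theorems.FilamentSkeletonRssRdssProfileTruncation
import Literature.Analysis.Calculus.RadiiPolynomial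
import Literature.Analysis.FluidPDE.SelfSimilarLiouville
import Summits.NavierStokesRegularity.NavierStokesRegularity.Theorems.QuantisedSymmetryLiouvilleKillsProfile
import HarnessLib

/-!
# Strategist sketch `s15-g2` (census family `s`, gen 2, INDEPENDENT) for the crux
`QuantisedSymmetry.PolyhedralDssProfileExists` (stmt-NavierStokesRegularity-1404)

Typed, sorry-free companion of `STRATEGY-CENSUS-s15.md` (strategist seat
`cstrat-stmt-NavierStokesRegularity-1404-s15-g2`).  Nothing in this file is a line of attack on the crux;
every theorem documents WHY one switch of the census gives no leverage short of the summit: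

* §0 `crux_decides_negatively` — the crux ALONE proves `¬ NavierStokesRegularity` (both other binders of
  `QuantisedSymmetry.closes` are landed theorems), so the crux is summit-deciding as typed.
* §1 the ladder of strictly-weaker intermediates obtained by deleting hypotheses of the crux:
  `W1 = Blowup.BlowupTypeIDssProfile` (symmetry deleted) still decides `¬ NavierStokesRegularity` by LANDED
  theorems (`w1_decides`), i.e. it is summit-deciding too and is another route's open crux (stmt-0155);
  `W2 = TypeIAncientProfileExists` (self-similarity deleted as well) decides `¬ NavierStokesRegularity` only
  through the OPEN bridge `AncientHullSteering.AncientTruncationBridge` (stmt-20185) (`w2_decides_of_bridge`).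
* §2 two typed decompositions with PROVED assemblies — (A) ε-forced profiles + compactness,
  (B) radii-polynomial certificate + the in-tree Newton–Kantorovich theorem — and the PROVED collapse of the
  "new" piece back onto the crux (`forcedProfiles_of_crux`, `certifiedCell_iff_crux`).
* §3 the prescribed-group strengthening (trivially above the crux).

[folklore] assembled from landed declarations only; see the census for the literature.
-/

set_option linter.dupNamespace false
set_option linter.unusedVariables false
set_option autoImplicit false

namespace Summit.NavierStokesRegularity.NavierStokesRegularity.Cruxes.PolyhedralDssProfileExists.S15g2

open MeasureTheory Metric Set Filter
open scoped Topology
open Literature.Analysis.FluidPDE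

/-- Physical space `ℝ³` (reducible abbreviation, local to this sketch). [folklore] -/
abbrev E3 : Type := EuclideanSpace ℝ (Fin 3)

/-! ## §0  The crux alone decides the summit (negatively) -/

/-- `PolyhedralDssProfileExists → ¬ NavierStokesRegularity`: the two other binders of the route's deciding
theorem are the landed `quantisedSymmetry_polyhedralTruncationBridge_proof` (stmt-11331, an instance of the
sector-agnostic RDSS bridge stmt-11289 at `R = 1`) and `ClayUniqueness_holds` (stmt-2599). [folklore] -/
theorem crux_decides_negatively (hX : Theses.QuantisedSymmetry.PolyhedralDssProfileExists) :
    ¬ _root_.NavierStokesRegularity :=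
  Theses.QuantisedSymmetry.closes hX Theorems.quantisedSymmetry_polyhedralTruncationBridge_proof
    Theses.QuantisedSymmetry.ClayUniqueness_holds

/-! ## §1  The weaker-intermediate ladder -/

/-- Rung W1 (delete the polyhedral symmetry): `crux → Blowup.BlowupTypeIDssProfile` (stmt-0155), the
registered stub `stub_dominatesBlowupProfile` of line `polyhedral_cell`. [folklore] -/
theorem w1_of_crux :
    Theses.QuantisedSymmetry.PolyhedralDssProfileExists → Theses.Blowup.BlowupTypeIDssProfile :=
  Theorems.PolyhedralDssProfileExists.PolyhedralCell.stub_dominatesBlowupProfile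

/-- W1 already yields a finite-time blow-up from a smooth rapidly decaying Leray–Hopf datum (X5a), by the
landed sector-agnostic RDSS truncation bridge `filamentSkeletonRss_rdssProfileTruncation_proof`
(stmt-11289): unpack `¬ ∀ c, (TypeIDSSLiouville c ∧ ∀ R, RotatedTypeIDSSLiouville c R)` classically into a
nontrivial (rotated) DSS Type-I ancient mild solution and feed the bridge (plain DSS = rotated DSS with
`R = 1`, `isRotatedDSS_refl_iff`). [folklore] -/
theorem blowupExists_of_w1 (h : Theses.Blowup.BlowupTypeIDssProfile) : Theses.Blowup.BlowupExists := by
  classical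
  dsimp only [Theses.Blowup.BlowupTypeIDssProfile] at h
  obtain ⟨c, hc⟩ := not_forall.mp h
  have key : ∃ (R : E3 ≃ₗᵢ[ℝ] E3) (u : ℝ → E3 → E3), 1 < c ∧ IsAncientMildSolution 1 u ∧
      (∀ t < 0, AEStronglyMeasurable (u t) volume) ∧ IsRotatedDSS c R u ∧
      (∃ C₀ : ℝ, HasTypeIDecay C₀ u) ∧ ¬ (∀ t < 0, u t =ᵐ[volume] 0) := by
    by_contra hcon
    apply hc
    constructor
    · intro hc1 u hu hmeas hdss hdec
      by_contra hnt
      exact hcon ⟨LinearIsometryEquiv.refl ℝ E3, u, hc1, hu, hmeas, isRotatedDSS_refl_iff.mpr hdss,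
        hdec, hnt⟩
    · intro R hc1 u hu hmeas hrdss hdec
      by_contra hnt
      exact hcon ⟨R, u, hc1, hu, hmeas, hrdss, hdec, hnt⟩
  obtain ⟨R, u, hc1, hu, hmeas, hrdss, hdec, hnt⟩ := key
  exact Theorems.filamentSkeletonRss_rdssProfileTruncation_proof ⟨c, R, u, hc1, hu, hmeas, hrdss, hdec, hnt⟩

/-- Hence W1 is itself summit-deciding by landed theorems: `Blowup.closes` with the landed
`Blowup.BlowupClayUniqueness_holds`. [folklore] -/
theorem w1_decides (h : Theses.Blowup.BlowupTypeIDssProfile) : ¬ _root_.NavierStokesRegularity :=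
  Theses.Blowup.closes (blowupExists_of_w1 h) Theses.Blowup.BlowupClayUniqueness_holds

/-- Rung W2 (delete symmetry AND discrete self-similarity): a nontrivial ancient mild solution with Type-I
space–time decay — verbatim the antecedent of `AncientHullSteering.AncientTruncationBridge` (stmt-20185).
[folklore] -/
def TypeIAncientProfileExists : Prop :=
  ∃ u : ℝ → E3 → E3, IsAncientMildSolution 1 u ∧ (∀ t < 0, AEStronglyMeasurable (u t) volume) ∧
    (∃ C₀ : ℝ, HasTypeIDecay C₀ u) ∧ ¬ (∀ t < 0, u t =ᵐ[volume] 0)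

/-- `crux → W2` (forget `G`, `c`). [folklore] -/
theorem w2_of_crux (hX : Theses.QuantisedSymmetry.PolyhedralDssProfileExists) :
    TypeIAncientProfileExists := by
  obtain ⟨G, -, -, -, c, -, u, hu, hmeas, -, hdec, -, hnt⟩ := hX
  exact ⟨u, hu, hmeas, hdec, hnt⟩

/-- W2 decides `¬ NavierStokesRegularity` only THROUGH the open bridge stmt-20185 (non-self-similar Type-I
truncation); with it, `Blowup.closes` finishes. [folklore] -/
theorem w2_decides_of_bridge (hB : Theses.AncientHullSteering.AncientTruncationBridge)
    (h : TypeIAncientProfileExists) : ¬ _root_.NavierStokesRegularity := by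
  obtain ⟨ν, hν, T, hT, u, p, hmax, hLH, hdec, -⟩ := hB h
  exact Theses.Blowup.closes ⟨ν, hν, T, hT, u, p, hmax, hLH, hdec⟩ Theses.Blowup.BlowupClayUniqueness_holds

/-! ## §2  Typed decompositions and their collapse

### Split A — ε-forced profiles (A1) + compactness (A2)
-/

/-- **A1 `ForcedProfiles`.**  For an admissible group `G`, a factor `c > 1` and UNIFORM constants
`C₀, t₀ < 0, R₁, ε₁ > 0`: for every `ε > 0` there is a `c`-DSS, `G`-equivariant, Type-I(`C₀`) field `u`,
weakly divergence free with measurable slices, which is an ancient mild solution of Navier–Stokes WITH A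
FORCE `f` obeying the scale-invariant smallness `‖f(t,x)‖ ≤ ε / (‖x‖ + √(−t))³`, and whose slice `u t₀`
exceeds `ε₁` on a subset of `B̄_{R₁}` of positive measure (an honest floor: a pointwise floor would be
satisfiable by null-set modifications of `0`). [folklore] -/
def ForcedProfiles : Prop :=
  ∃ G : Subgroup (E3 ≃ₗᵢ[ℝ] E3), Finite G ∧
    (∀ g ∈ G, LinearMap.det (g.toLinearEquiv : E3 →ₗ[ℝ] E3) = 1) ∧
    (∀ V : Submodule ℝ E3, (∀ g ∈ G, ∀ v ∈ V, g v ∈ V) → V = ⊥ ∨ V = ⊤) ∧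
    ∃ c : ℝ, 1 < c ∧ ∃ C₀ t₀ R₁ ε₁ : ℝ, t₀ < 0 ∧ 0 < ε₁ ∧ ∀ ε : ℝ, 0 < ε →
      ∃ f u : ℝ → E3 → E3,
        (∀ t < 0, ∀ x, ‖f t x‖ ≤ ε / (‖x‖ + Real.sqrt (-t)) ^ 3) ∧
        (∀ t < 0, IsWeaklyDivFree (u t)) ∧
        (∀ s t : ℝ, s < t → t < 0 → IsMildNSSolutionBetween 1 f u s t) ∧
        (∀ t < 0, AEStronglyMeasurable (u t) volume) ∧
        IsDiscretelySelfSimilar c u ∧ HasTypeIDecay C₀ u ∧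
        (∀ g ∈ G, ∀ t x, u t (g x) = g (u t x)) ∧
        0 < volume {x : E3 | ‖x‖ ≤ R₁ ∧ ε₁ ≤ ‖u t₀ x‖}

/-- **A2 `ForcedCompactness`.**  A forced family as in A1 (uniform `G, c, C₀, t₀, R₁, ε₁`, residual
`ε → 0`) has a nontrivial unforced limit: a `c`-DSS, `G`-equivariant, Type-I ancient mild solution which is
not a.e. trivial.  (Plausible M/L theorem: Type-I localises the floor to `|x| ≤ R₁`, local parabolic
regularity under small forcing gives `C^α_loc` compactness, the integral identities pass to the limit, the
positive-measure floor survives.) [folklore] -/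
def ForcedCompactness : Prop :=
  ∀ G : Subgroup (E3 ≃ₗᵢ[ℝ] E3), Finite G →
    (∀ g ∈ G, LinearMap.det (g.toLinearEquiv : E3 →ₗ[ℝ] E3) = 1) →
    (∀ V : Submodule ℝ E3, (∀ g ∈ G, ∀ v ∈ V, g v ∈ V) → V = ⊥ ∨ V = ⊤) →
    ∀ c : ℝ, 1 < c → ∀ C₀ t₀ R₁ ε₁ : ℝ, t₀ < 0 → 0 < ε₁ →
      (∀ ε : ℝ, 0 < ε → ∃ f u : ℝ → E3 → E3,
        (∀ t < 0, ∀ x, ‖f t x‖ ≤ ε / (‖x‖ + Real.sqrt (-t)) ^ 3) ∧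
        (∀ t < 0, IsWeaklyDivFree (u t)) ∧
        (∀ s t : ℝ, s < t → t < 0 → IsMildNSSolutionBetween 1 f u s t) ∧
        (∀ t < 0, AEStronglyMeasurable (u t) volume) ∧
        IsDiscretelySelfSimilar c u ∧ HasTypeIDecay C₀ u ∧
        (∀ g ∈ G, ∀ t x, u t (g x) = g (u t x)) ∧
        0 < volume {x : E3 | ‖x‖ ≤ R₁ ∧ ε₁ ≤ ‖u t₀ x‖}) →
      ∃ u : ℝ → E3 → E3, IsAncientMildSolution 1 u ∧ (∀ t < 0, AEStronglyMeasurable (u t) volume) ∧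
        IsDiscretelySelfSimilar c u ∧ (∃ C : ℝ, HasTypeIDecay C u) ∧
        (∀ g ∈ G, ∀ t x, u t (g x) = g (u t x)) ∧ ¬ (∀ t < 0, u t =ᵐ[volume] 0)

/-- **Assembly of Split A (proved):** `A1 → A2 → crux`. [folklore] -/
theorem crux_of_forced (hA1 : ForcedProfiles) (hA2 : ForcedCompactness) :
    Theses.QuantisedSymmetry.PolyhedralDssProfileExists := by
  obtain ⟨G, hGfin, hGdet, hGirr, c, hc, C₀, t₀, R₁, ε₁, ht₀, hε₁, hfam⟩ := hA1
  obtain ⟨u, hu, hmeas, hdss, hdec, hequiv, hnt⟩ :=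
    hA2 G hGfin hGdet hGirr c hc C₀ t₀ R₁ ε₁ ht₀ hε₁ hfam
  exact ⟨G, hGfin, hGdet, hGirr, c, hc, u, hu, hmeas, hdss, hdec, hequiv, hnt⟩

/-- **Collapse of Split A (proved): `crux → A1`** — an exact profile is an `ε`-forced profile with `f = 0`
for every `ε`, and "not a.e. zero on the slice `t₀`" upgrades to a positive-measure quantitative floor on a
bounded ball (`{u t₀ ≠ 0} = ⋃ₙ {‖x‖ ≤ n ∧ 1/(n+1) ≤ ‖u t₀ x‖}`).  Hence, GIVEN the compactness lemma A2,
`A1 ↔ crux`: the formally weaker piece is the crux again. [folklore] -/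
theorem forcedProfiles_of_crux (hX : Theses.QuantisedSymmetry.PolyhedralDssProfileExists) :
    ForcedProfiles := by
  classical
  obtain ⟨G, hGfin, hGdet, hGirr, c, hc, u, ⟨hdiv, hmild⟩, hmeas, hdss, ⟨C₀, hdec⟩, hequiv, hnt⟩ := hX
  -- a slice which is not a.e. zero
  have h1 : ∃ t₀ : ℝ, t₀ < 0 ∧ ¬ (u t₀ =ᵐ[volume] 0) := by
    by_contra h
    push Not at h
    exact hnt h
  obtain ⟨t₀, ht₀, hne⟩ := h1
  -- a quantitative positive-measure floor on a bounded ball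
  have h2 : ∃ n : ℕ, 0 < volume {x : E3 | ‖x‖ ≤ (n : ℝ) ∧ 1 / ((n : ℝ) + 1) ≤ ‖u t₀ x‖} := by
    by_contra h
    push Not at h
    apply hne
    have hcover : {x : E3 | u t₀ x ≠ 0} ⊆
        ⋃ n : ℕ, {x : E3 | ‖x‖ ≤ (n : ℝ) ∧ 1 / ((n : ℝ) + 1) ≤ ‖u t₀ x‖} := by
      intro x hx
      have hpos : 0 < ‖u t₀ x‖ := norm_pos_iff.mpr hx
      obtain ⟨n, hn⟩ := exists_nat_ge (max ‖x‖ (1 / ‖u t₀ x‖))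
      refine Set.mem_iUnion.mpr ⟨n, le_trans (le_max_left _ _) hn, ?_⟩
      have h1n : 1 / ‖u t₀ x‖ ≤ (n : ℝ) + 1 := by linarith [le_trans (le_max_right _ _) hn]
      have hmul : ‖u t₀ x‖ * (1 / ‖u t₀ x‖) ≤ ‖u t₀ x‖ * ((n : ℝ) + 1) :=
        mul_le_mul_of_nonneg_left h1n (le_of_lt hpos)
      rw [mul_one_div_cancel (ne_of_gt hpos)] at hmul
      rw [div_le_iff₀ (by positivity)]
      linarith
    have hnull : volume {x : E3 | u t₀ x ≠ 0} = 0 :=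
      measure_mono_null hcover (measure_iUnion_null fun n => nonpos_iff_eq_zero.mp (h n))
    exact ae_iff.mpr hnull
  obtain ⟨n, hn⟩ := h2
  refine ⟨G, hGfin, hGdet, hGirr, c, hc, C₀, t₀, (n : ℝ), 1 / ((n : ℝ) + 1), ht₀, by positivity, ?_⟩
  intro ε hε
  refine ⟨0, u, ?_, hdiv, hmild, hmeas, hdss, hdec, hequiv, hn⟩
  intro t ht x
  simp only [Pi.zero_apply, norm_zero]
  positivity

/-! ### Split B — radii-polynomial certificate (B1) + Newton–Kantorovich (B2, a theorem in tree) -/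

/-- **B1 `CertifiedCell`.**  A zero-finding problem `F : X → Y` on a real Banach space carrying a complete
radii-polynomial certificate (the hypotheses of `Literature.Analysis.Calculus.existsUnique_zero_of_radiiPolynomial`,
= Calleja et al. 2021 Thm 8 / Hungria–Lessard–Mireles James 2016) together with a REPRESENTATION clause:
every zero of `F` in the certified ball yields a polyhedral DSS profile.  This is the honest typed form of
"computer-assisted construction of the cell" before a concrete `F` (the period map of the cell formulation on
a concrete weighted space) and concrete numbers `x̄, Y₀, Z₀, Z₁, Z₂, r` exist. [folklore] -/
def CertifiedCell : Prop :=
  ∃ (X : Type) (i₁ : NormedAddCommGroup X) (i₂ : NormedSpace ℝ X) (i₃ : CompleteSpace X)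
    (Y : Type) (i₄ : NormedAddCommGroup Y) (i₅ : NormedSpace ℝ Y)
    (F : X → Y) (F' : X → X →L[ℝ] Y) (xbar : X) (A : Y →L[ℝ] X) (Adag : X →L[ℝ] Y)
    (Y₀ Z₀ Z₁ Z₂ r : ℝ),
    0 < r ∧ Function.Injective A ∧ (∀ x ∈ closedBall xbar r, HasFDerivAt F (F' x) x) ∧
    ‖A (F xbar)‖ ≤ Y₀ ∧ ‖ContinuousLinearMap.id ℝ X - A.comp Adag‖ ≤ Z₀ ∧
    ‖A.comp (F' xbar - Adag)‖ ≤ Z₁ ∧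
    (∀ b : X, ‖b‖ ≤ r → ‖A.comp (F' (xbar + b) - F' xbar)‖ ≤ Z₂ * r) ∧
    Z₂ * r ^ 2 + (Z₁ + Z₀ - 1) * r + Y₀ < 0 ∧
    (∀ x ∈ closedBall xbar r, F x = 0 → Theses.QuantisedSymmetry.PolyhedralDssProfileExists)

/-- **Assembly of Split B (proved, B2 discharged in tree):** `B1 → crux`, by the landed radii-polynomial
theorem `existsUnique_zero_of_radiiPolynomial`. [folklore] -/
theorem crux_of_certifiedCell (h : CertifiedCell) :
    Theses.QuantisedSymmetry.PolyhedralDssProfileExists := by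
  obtain ⟨X, i₁, i₂, i₃, Y, i₄, i₅, F, F', xbar, A, Adag, Y₀, Z₀, Z₁, Z₂, r, hr, hA, hF, hY, hZ₀, hZ₁,
    hZ₂, hp, hrep⟩ := h
  obtain ⟨x, hx, hFx, -⟩ :=
    Literature.Analysis.Calculus.existsUnique_zero_of_radiiPolynomial hr hA hF hY hZ₀ hZ₁ hZ₂ hp
  exact hrep x hx hFx

/-- **Collapse of Split B (proved): `crux → B1`** with the trivial certificate (`X = Y = ℝ`, `F = id`,
`x̄ = 0`, `A = A† = id`, `Y₀ = Z₀ = Z₁ = Z₂ = 0`, `r = 1`).  So `B1 ↔ crux`: the certificate language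
carries no content until `F` is a CONCRETE map with a proved zero-to-profile theorem and the five numbers
are in hand — neither exists. [folklore] -/
theorem certifiedCell_of_crux (hX : Theses.QuantisedSymmetry.PolyhedralDssProfileExists) :
    CertifiedCell := by
  refine ⟨ℝ, inferInstance, inferInstance, inferInstance, ℝ, inferInstance, inferInstance,
    id, fun _ => ContinuousLinearMap.id ℝ ℝ, 0, ContinuousLinearMap.id ℝ ℝ, ContinuousLinearMap.id ℝ ℝ,
    0, 0, 0, 0, 1, one_pos, fun a b h => by simpa using h, fun x _ => hasFDerivAt_id x, ?_, ?_, ?_, ?_,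
    by norm_num, fun _ _ _ => hX⟩
  · simp
  · simp
  · simp
  · intro b hb
    simp

/-- `B1 ↔ crux`. [folklore] -/
theorem certifiedCell_iff_crux :
    CertifiedCell ↔ Theses.QuantisedSymmetry.PolyhedralDssProfileExists :=
  ⟨crux_of_certifiedCell, certifiedCell_of_crux⟩

/-! ### Split C — symmetry-free profile (C1 = W1) + symmetrisation (C2)

`C1 := Blowup.BlowupTypeIDssProfile`, `C2 := C1 → crux`; the assembly is modus ponens, but the piece C1
is summit-deciding on its own (`w1_decides`), so the split violates "no piece decides S by itself", and C2
(symmetrising a nonlinear profile) has no mechanism.  Recorded as a theorem for the census: -/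

/-- Piece C1 of Split C decides the summit alone. [folklore] -/
theorem splitC_piece_decides : Theses.Blowup.BlowupTypeIDssProfile → ¬ _root_.NavierStokesRegularity :=
  w1_decides

/-! ## §3  Strengthenings -/

/-- S⁺(G₀): the crux at a PRESCRIBED admissible group is trivially above the crux; prescribing `G₀`
(e.g. the chiral octahedral group of `OctWitness.routeGClass_inhabited`) adds a finite-dimensional
reduction of the cell but no existence mechanism. [folklore] -/
theorem crux_of_fixedGroup (G₀ : Subgroup (E3 ≃ₗᵢ[ℝ] E3)) (hfin : Finite G₀)
    (hdet : ∀ g ∈ G₀, LinearMap.det (g.toLinearEquiv : E3 →ₗ[ℝ] E3) = 1)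
    (hirr : ∀ V : Submodule ℝ E3, (∀ g ∈ G₀, ∀ v ∈ V, g v ∈ V) → V = ⊥ ∨ V = ⊤)
    (h : ∃ c : ℝ, 1 < c ∧ ∃ u : ℝ → E3 → E3, IsAncientMildSolution 1 u ∧
      (∀ t < 0, AEStronglyMeasurable (u t) volume) ∧ IsDiscretelySelfSimilar c u ∧
      (∃ C₀ : ℝ, HasTypeIDecay C₀ u) ∧ (∀ g ∈ G₀, ∀ t x, u t (g x) = g (u t x)) ∧
      ¬ (∀ t < 0, u t =ᵐ[volume] 0)) :
    Theses.QuantisedSymmetry.PolyhedralDssProfileExists :=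
  ⟨G₀, hfin, hdet, hirr, h⟩

/-- The kill switch in the other direction (landed, stmt-11297 `LiouvilleKillsProfile`): the polyhedral
Type-I Liouville statement (stmt-1405) refutes the crux; restated so the census can point at one file.
[folklore] -/
theorem liouville_kills (hL : Theses.QuantisedSymmetry.PolyhedralTypeILiouville) :
    ¬ Theses.QuantisedSymmetry.PolyhedralDssProfileExists :=
  Theorems.quantisedSymmetry_liouvilleKillsProfile_proof hL

end Summit.NavierStokesRegularity.NavierStokesRegularity.Cruxes.PolyhedralDssProfileExists.S15g2
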